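import Mathlib.GroupTheory.Index
import Mathlib.GroupTheory.SpecificGroups.Dihedral
import Mathlib.Data.ZMod.Basic
import Mathlib.Tactic.LinearCombination
import Literature.Computability.AlgebraicComplexity.CohnUmansDihedralSubgroupTPP
import HarnessLib

/-!
# Murthy 2025, Example 4.2: the subgroup TPP ratio `p²/(2p − 1) = 4/3` is attained by every
dihedral group `D_{6m}`

Topic `Literature/Computability/AlgebraicComplexity` (group-theoretic matrix multiplication; TPP
capacity), namespace `Literature.Computability.AlgebraicComplexity.Murthy2025`.  Companion of
`SubgroupTPPAbelianPrimeIndex.lean` (Murthy 2025, Thm. 4.1: `(2p − 1)|S||T||U| ≤ p²|G|` for subgroup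
TPP triples of a finite group with an abelian normal subgroup of prime index `p`).

S. R. Murthy, *A note on the triple product property for finite groups with abelian normal subgroups
of prime index*, arXiv:2512.16730v7 (2026), Example 4.2 (p. 9), verbatim: "A simple illustration of
the theorem (and the idea of coset decomposition) is given below using the dihedral group `D_{2n}` of
order `2n` where `n` is divisible by `3`, that is, `n = 3m` for some positive integer `m` (so that
`|D_{2n}| = 6m`), and the equality `ρ₀(G) = p²/(2p−1)` is achieved for `p = 2`.  Using the standard
presentation `⟨r, f | rⁿ = r^{3m} = 1, f² = 1, f r f = r⁻¹⟩` of `D_{2n}`, and letting `H` be the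
cyclic subgroup `⟨r⟩` … of order `n = 3m` (and index `2`) …, consider the subgroups
`S = ⟨r³, f⟩ = {r^{3i} fʲ | i ∈ ℤ_m, j ∈ ℤ₂}`, `T = ⟨f r⟩ = {1, f r}`, `U = ⟨f r²⟩ = {1, f r²}` …
Clearly, `T ∩ U = {1}`, and it is easy to check that `TU = {1, f r, f r², r}` and `S ∩ TU = {1}`.
Thus `(S, T, U)` is a (subgroup) TPP triple of `D_{2n}` of type `(⅔n, 2, 2) = (2m, 2, 2)` and size
`8/3 · n = 8m`, thus achieving `ρ₀(D_{2n}) = 4/3`."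

## What is here (all proved; 0 named facts)

In Mathlib's `DihedralGroup (3 * m)` (`r i`, `sr i`; the book's `f rⁱ` is `sr i`):

* `Murthy2025.exampleS m` — the subgroup `S = ⟨r³, f⟩ = {r^i, f r^i : 3 ∣ i}` (an explicit subgroup
  structure on that set), `Murthy2025.card_exampleS : |S| = 2m` (`m ≥ 1`);
* `Murthy2025.example42_subgroupTPP` — `(S, ⟨f r⟩, ⟨f r²⟩)` is a subgroup TPP triple (the tree's
  `DihedralSubgroups.SubgroupTPP`);
* `Murthy2025_example42` — `[D_{6m} : ⟨r⟩] = 2` and `3 · (|S| |T| |U|) = 3 · 8m = 4 · |D_{6m}|`, i.e.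
  equality in Thm. 4.1 with `p = 2` (for every positive `m`, as printed).

## References
* S. R. Murthy, arXiv:2512.16730v7 (2026), Example 4.2 (p. 9); Thm. 4.1 (p. 7). [Murthy2025TPPIndexP]
* H. Cohn, C. Umans, FOCS 2003, arXiv:math/0307321, Def. 2.1 (TPP; for subgroups `Q(H) = H`).
  [CohnUmans2003]
-/

namespace Literature.Computability.AlgebraicComplexity

namespace Murthy2025

open DihedralSubgroups DihedralGroup

variable (m : ℕ)

/-- The exponents divisible by `3`: the subgroup `3ℤ_{3m} = ⟨3⟩ ≤ ℤ_{3m}` (so that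
`⟨r³⟩ = {rⁱ : i ∈ 3ℤ_{3m}}`). [cite: Murthy2025TPPIndexP, Example 4.2 (`S₀ = ⟨r³⟩`)] -/
abbrev mult3 : AddSubgroup (ZMod (3 * m)) := AddSubgroup.zmultiples (3 : ZMod (3 * m))

/-- **`S = ⟨r³, f⟩ = {r^{3i} fʲ}`** as a subgroup of `D_{6m}`: the rotations and reflections whose
exponent is divisible by `3`. [cite: Murthy2025TPPIndexP, Example 4.2 (p. 9)] -/
def exampleS : Subgroup (DihedralGroup (3 * m)) where
  carrier := {g | ∃ i ∈ mult3 m, g = r i ∨ g = sr i}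
  one_mem' := ⟨0, zero_mem _, Or.inl (one_def)⟩
  mul_mem' := by
    rintro _ _ ⟨i, hi, rfl | rfl⟩ ⟨j, hj, rfl | rfl⟩
    · exact ⟨i + j, add_mem hi hj, Or.inl (r_mul_r i j)⟩
    · exact ⟨j - i, sub_mem hj hi, Or.inr (r_mul_sr i j)⟩
    · exact ⟨i + j, add_mem hi hj, Or.inr (sr_mul_r i j)⟩
    · exact ⟨j - i, sub_mem hj hi, Or.inl (sr_mul_sr i j)⟩
  inv_mem' := by
    rintro _ ⟨i, hi, rfl | rfl⟩
    · exact ⟨-i, neg_mem hi, Or.inl (inv_r i)⟩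
    · exact ⟨i, hi, Or.inr (inv_sr i)⟩

/-- Membership in `S`, by definition. [cite: Murthy2025TPPIndexP, Example 4.2 (p. 9)] -/
theorem mem_exampleS {g : DihedralGroup (3 * m)} :
    g ∈ exampleS m ↔ ∃ i ∈ mult3 m, g = r i ∨ g = sr i := Iff.rfl

/-- `|3ℤ_{3m}| = m`. [cite: Murthy2025TPPIndexP, Example 4.2 ("`r³` of order `n/3 = m`")] -/
theorem card_mult3 : Nat.card (mult3 m) = m := by
  rw [mult3, Nat.card_zmultiples]
  have h : addOrderOf ((3 : ℕ) : ZMod (3 * m)) = 3 * m / (3 * m).gcd 3 :=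
    ZMod.addOrderOf_coe' (n := 3 * m) (a := 3) (by norm_num)
  rw [Nat.cast_ofNat] at h
  rw [h, Nat.gcd_eq_right (dvd_mul_right 3 m), Nat.mul_div_cancel_left m (by norm_num)]

/-- **`|S| = 2m`** ("a subgroup of order `⅔ n = 2m`"): `S` is in bijection with two copies of
`3ℤ_{3m}`. [cite: Murthy2025TPPIndexP, Example 4.2 (p. 9)] -/
theorem card_exampleS (hm : 0 < m) : Nat.card (exampleS m) = 2 * m := by
  classical
  haveI : Finite (mult3 m) := Nat.finite_of_card_ne_zero (by rw [card_mult3]; omega)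
  let f : mult3 m ⊕ mult3 m → exampleS m := fun x =>
    match x with
    | Sum.inl i => ⟨r i, i, i.2, Or.inl rfl⟩
    | Sum.inr i => ⟨sr i, i, i.2, Or.inr rfl⟩
  have hf : Function.Bijective f := by
    constructor
    · rintro (⟨i, hi⟩ | ⟨i, hi⟩) (⟨j, hj⟩ | ⟨j, hj⟩) h <;>
        simp only [f, Subtype.mk.injEq, r.injEq, sr.injEq, reduceCtorEq] at h
      · subst h; rfl
      · subst h; rfl
    · rintro ⟨g, i, hi, rfl | rfl⟩
      · exact ⟨Sum.inl ⟨i, hi⟩, rfl⟩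
      · exact ⟨Sum.inr ⟨i, hi⟩, rfl⟩
  rw [← Nat.card_congr (Equiv.ofBijective f hf), Nat.card_sum, card_mult3]
  ring

/-- Reduction mod `3`: every element of `3ℤ_{3m}` maps to `0` in `ℤ₃`, so `1, 2, −1 ∉ 3ℤ_{3m}`
("`S₃` is a subgroup iff `m` is a multiple of `3`", CU03; here `3 ∣ 3m`).
[cite: Murthy2025TPPIndexP, Example 4.2 (p. 9)] -/
theorem castHom_eq_zero_of_mem {i : ZMod (3 * m)} (hi : i ∈ mult3 m) :
    ZMod.castHom (dvd_mul_right 3 m) (ZMod 3) i = 0 := by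
  obtain ⟨k, rfl⟩ := AddSubgroup.mem_zmultiples_iff.1 hi
  rw [map_zsmul, map_ofNat]
  have h3 : (3 : ZMod 3) = 0 := by decide
  rw [h3, smul_zero]

/-- `1 ∉ 3ℤ_{3m}`. [cite: Murthy2025TPPIndexP, Example 4.2 (p. 9)] -/
theorem one_not_mem_mult3 : (1 : ZMod (3 * m)) ∉ mult3 m := fun h => by
  have := castHom_eq_zero_of_mem m h
  rw [map_one] at this
  exact absurd this (by decide)

/-- `2 ∉ 3ℤ_{3m}`. [cite: Murthy2025TPPIndexP, Example 4.2 (p. 9)] -/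
theorem two_not_mem_mult3 : (2 : ZMod (3 * m)) ∉ mult3 m := fun h => by
  have := castHom_eq_zero_of_mem m h
  rw [map_ofNat] at this
  exact absurd this (by decide)

/-- `−1 ∉ 3ℤ_{3m}`. [cite: Murthy2025TPPIndexP, Example 4.2 (p. 9)] -/
theorem neg_one_not_mem_mult3 : (-1 : ZMod (3 * m)) ∉ mult3 m := fun h =>
  one_not_mem_mult3 m (by simpa using neg_mem h)

/-- The elements of `⟨f rⁱ⟩` are `1` and `f rⁱ`. [cite: Murthy2025TPPIndexP, Example 4.2
("`T = ⟨fr⟩ = {1, fr}`")] -/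
theorem mem_zpowers_sr {n : ℕ} {i : ZMod n} {g : DihedralGroup n} (hg : g ∈ Subgroup.zpowers (sr i)) :
    g = 1 ∨ g = sr i := by
  obtain ⟨k, rfl⟩ := Subgroup.mem_zpowers_iff.mp hg
  rcases Int.even_or_odd k with ⟨l, rfl⟩ | ⟨l, rfl⟩
  · left
    rw [← two_mul, zpow_mul, zpow_ofNat, pow_two, sr_mul_sr, sub_self, ← one_def, one_zpow]
  · right
    rw [zpow_add, zpow_mul, zpow_ofNat, pow_two, sr_mul_sr, sub_self, ← one_def, one_zpow, one_mul,
      zpow_one]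

/-- **Example 4.2, the TPP check** ("Clearly, `T ∩ U = {1}`, and … `TU = {1, fr, fr², r}` and
`S ∩ TU = {1}`"): `(⟨r³, f⟩, ⟨fr⟩, ⟨fr²⟩)` is a subgroup TPP triple of `D_{6m}` — the eight words
`s t u` reduce to `rⁱ = 1`, or to one of `1, 2, −1 ∈ 3ℤ_{3m}`, or to `f r^… = 1`.
[cite: Murthy2025TPPIndexP, Example 4.2 (p. 9)] -/
theorem example42_subgroupTPP :
    SubgroupTPP (exampleS m) (Subgroup.zpowers (sr 1)) (Subgroup.zpowers (sr 2)) := by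
  intro a ha b hb c hc habc
  obtain ⟨i, hi, rfl | rfl⟩ := ha <;> rcases mem_zpowers_sr hb with rfl | rfl <;>
    rcases mem_zpowers_sr hc with rfl | rfl
  · exact ⟨by simpa using habc, rfl, rfl⟩
  · exfalso
    rw [mul_one, r_mul_sr, one_def] at habc
    cases habc
  · exfalso
    rw [mul_one, r_mul_sr, one_def] at habc
    cases habc
  · exfalso
    rw [r_mul_sr, sr_mul_sr, one_def] at habc
    have h0 : (2 : ZMod (3 * m)) - (1 - i) = 0 := r.inj habc
    have hi' : i = -1 := by linear_combination h0
    exact neg_one_not_mem_mult3 m (hi' ▸ hi)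
  · exfalso
    rw [mul_one, mul_one, one_def] at habc
    cases habc
  · exfalso
    rw [mul_one, sr_mul_sr, one_def] at habc
    have h0 : (2 : ZMod (3 * m)) - i = 0 := r.inj habc
    have hi' : i = 2 := by linear_combination -h0
    exact two_not_mem_mult3 m (hi' ▸ hi)
  · exfalso
    rw [mul_one, sr_mul_sr, one_def] at habc
    have h0 : (1 : ZMod (3 * m)) - i = 0 := r.inj habc
    have hi' : i = 1 := by linear_combination -h0
    exact one_not_mem_mult3 m (hi' ▸ hi)
  · exfalso
    rw [sr_mul_sr, r_mul_sr, one_def] at habc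
    cases habc

end Murthy2025

open DihedralSubgroups DihedralGroup Murthy2025

/-- **Murthy 2025, Example 4.2: `ρ₀(D_{6m}) = 4/3 = p²/(2p − 1)` (`p = 2`)** — the rotation subgroup
`⟨r⟩` of `D_{6m}` (abelian, normal) has index `2`, and the subgroup TPP triple
`(⟨r³, f⟩, ⟨fr⟩, ⟨fr²⟩)` has size `2m · 2 · 2 = 8m = (4/3) |D_{6m}|`, i.e. equality
`(2p − 1) |S||T||U| = p² |G|` in Thm. 4.1 (`SubgroupTPPAbelianPrimeIndex.lean`).
[cite: Murthy2025TPPIndexP, Example 4.2 (p. 9)] -/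
theorem Murthy2025_example42 (m : ℕ) (hm : 0 < m) :
    (Subgroup.zpowers (r 1 : DihedralGroup (3 * m))).index = 2 ∧
    SubgroupTPP (exampleS m) (Subgroup.zpowers (sr 1)) (Subgroup.zpowers (sr 2)) ∧
    Nat.card (exampleS m) = 2 * m ∧
    (2 * 2 - 1) * (Nat.card (exampleS m) * Nat.card (Subgroup.zpowers (sr 1 : DihedralGroup (3 * m))) *
        Nat.card (Subgroup.zpowers (sr 2 : DihedralGroup (3 * m)))) =
      2 ^ 2 * Nat.card (DihedralGroup (3 * m)) := by
  refine ⟨?_, example42_subgroupTPP m, card_exampleS m hm, ?_⟩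
  · have h := Subgroup.index_mul_card (Subgroup.zpowers (r 1 : DihedralGroup (3 * m)))
    rw [Nat.card_zpowers, orderOf_r_one, nat_card] at h
    exact Nat.eq_of_mul_eq_mul_right (show 0 < 3 * m by omega) h
  · rw [card_exampleS m hm, Nat.card_zpowers, Nat.card_zpowers, orderOf_sr, orderOf_sr, nat_card]
    ring

end Literature.Computability.AlgebraicComplexity
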